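import Literature.NumberTheory.Automorphic.UpqGKModulePFiltration    -- ★ p831041 (A-p14 (g23)): N1 `upqPStep`, `upqPFiltration`, frame lemmas
import Literature.NumberTheory.Automorphic.UpqComplexifiedAction     -- ★ (A-p14 (g23)): N3a `upqLieC`, `upqEOp`, `upqFOp`, relations, `K`-conjugation
import Literature.NumberTheory.Automorphic.UpqCasimirPPartKStable    -- ★ p831010 (A-p06 (g24)): N2 `upq_sum_pPart_mem_of_kStable_of_casimir`
import HarnessLib

/-!
# The bigraded levels `M_{a,b} = F^b E^a W₀` of a `(𝔤, K)`-module of `U(α, β)`: `F_n = Σ_{a+b ≤ n} M_{a,b}`, `z₀`-weights, `q`-reduction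

Topic `NumberTheory/Automorphic`; namespace `Literature.NumberTheory.Automorphic`.  DEFINITIONS with bodies (`upqEStep`, `upqFStep`, `upqLevel`) and
theorems; no named fact, no instance, no notation, no `sorry`.  Cell `hodgecm-mathlib`, F0∕P3, T1a arch line, road «V19 in-house for `U(2,1)`»
(★ `IrreducibleUnitaryKTypeGrowth`, [Varadarajan1989, §5.4 Thm. 19]): node N3b «bigraded levels» (seat A-p14 (g23); LEAD F0P3b-p01 (g2)), over N1 ★
`UpqGKModulePFiltration`, N3a ★ `UpqComplexifiedAction`, N2 ★ `UpqCasimirPPartKStable`.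

THE MATHEMATICS ([Varadarajan1989, §5.3 (proof of Thm. 10), §5.4]; [BorelWallach2000, II §4.1–4.2]; [WallachRRG1, §3.4]).  `𝔭_ℂ = 𝔭⁺ ⊕ 𝔭⁻` with
`𝔭^±` abelian, `[𝔭⁺, 𝔭⁻] ⊆ 𝔨_ℂ`, acting on a `(𝔤, K)`-module `V` of `U(α, β)` through the root operators `E_p := E_{E_{ab}}`, `F_p := F_{E_{ba}}` (`p = (a,b)`,
★ `upqEOp`, ★ `upqFOp`).  For a complex subspace `U` put `E·U := Σ_p E_p U` (`upqEStep`), `F·U := Σ_p F_p U` (`upqFStep`) and for a subspace `W₀` the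
BIGRADED LEVELS `M_{a,b} := F^b E^a W₀` (`upqLevel W₀ a b`).  Then:
* §1 `E_B U ⊆ E·U`, `F_C U ⊆ F·U` for all matrices `B`, `C`; `𝔭·U = E·U + F·U` (★ `upqPStep`; `ρ𝔤(X_{cE_p}) = c E_p + c̄ F_p`, and conversely
  `E_B = ρ𝔤(A e_B) + i ρ𝔤(B e_B)` with `A e_B`, `B e_B ∈ 𝔭`);
* §2 if `U` is `K`-stable (and the `(𝔤, K)`-axioms hold) then `E·U`, `F·U` are `K`-stable (★ `ρK_upqEOp_apply`) and
  `E·(F·U) ⊆ F·(E·U) + U` (`[E_p, F_q] ∈ ρ_ℂ(𝔨_ℂ)` preserves the `𝔨`-stable `U`); hence `E·(F^b X) ⊆ F^b(E·X) + Σ_{j<b} F^j X`;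
* §3 **`F_n = Σ_{a+b ≤ n} M_{a,b}`** (★ `upqPFiltration`) for `K`-stable `W₀`; every `M_{a,b}` is `K`-stable, and finite-dimensional when `W₀` is;
* §4 **`z₀`-WEIGHTS**: if `ρ𝔤(z₀)` acts on `W₀` by the scalar `μ` then it acts on `M_{a,b}` by `μ + i(a − b)` (★ `ρ𝔤_upqZ0_mul_upqEOp_sub`:
  `[ρ𝔤 z₀, E_B] = i E_B`, `[ρ𝔤 z₀, F_C] = −i F_C`) — the levels on different diagonals `a − b = δ` lie in different eigenspaces of `ρ𝔤(z₀)`;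
* §5 **`q`-REDUCTION** (N2): `Σ_s ρ𝔤(x_s)² = Σ_p (E_p F_p + F_p E_p)` (the frame ★ `upqPBasis` is `B`-orthonormal), so when the Casimir acts by a scalar (★ N0
  for irreducible `V`) `Σ_p F_p E_p` and `Σ_p E_p F_p` preserve every `K`-stable subspace; in particular `Σ_p F_p E_p (E^a W₀) ⊆ E^a W₀`, i.e. the symbol
  `q = Σ_p F_p E_p ∈ Sym(𝔭⁻) ⊗ Sym(𝔭⁺)` maps level `(a, b)` into level `(a−1, b−1)` ⊆ `F_{a+b−2}` — the harmonic quotient `𝓗^{a,b} ⊗ W₀ ↠ M_{a,b} ∕ lower`.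

HONEST LABEL: kernel definitions∕theorems about abstract `(𝔤, K)`-modules of `U(α, β)`; nothing printed about HC_CM is discharged here.  HC_CM is proved only
modulo the 2 remaining named inputs (hLiu418, h413) until rung 0 closes.

## References
* V. S. Varadarajan, *An Introduction to Harmonic Analysis on Semisimple Lie Groups* (1989), §5.3 (proof of Thm. 10), §5.4. [Varadarajan1989]
* A. Borel, N. Wallach, *Continuous Cohomology, Discrete Subgroups, and Representations of Reductive Groups*, 2nd ed. (2000), II §4.1–4.2. [BorelWallach2000]
* N. R. Wallach, *Real Reductive Groups I* (1988), §3.4. [WallachRRG1]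
-/

-- Mathlib idiom (as in ★ `GKModules` and every `(𝔤, K)` file of the tree): the commutator bracket on `Module.End ℂ V` and on matrices, needed to
-- MENTION `ρ𝔤 : (uFormGroup α β).lie →ₗ⁅ℝ⁆ Module.End ℂ V` (`LieRing.ofAssociativeRing` is a `def` in Mathlib, not a global instance).
attribute [local instance 100] LieRing.ofAssociativeRing

set_option autoImplicit false

open scoped MatrixGroups Matrix ComplexConjugate

noncomputable section

namespace Literature.NumberTheory.Automorphic

open Literature.RepresentationTheory Literature.RepresentationTheory.BorelWallach2000 Literature.RepresentationTheory.KonnoKonno2007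
open Literature.RepresentationTheory.KonnoKonno2007.RealDualPair (signForm)

variable {α β : Type} [Fintype α] [DecidableEq α] [Fintype β] [DecidableEq β]
variable {V : Type*} [AddCommGroup V] [Module ℂ V]
  (ρK : Representation ℂ (uFormGroup α β).maximalCompact V) (ρ𝔤 : (uFormGroup α β).lie →ₗ⁅ℝ⁆ Module.End ℂ V)

/-! ## §1 The steps `E·U`, `F·U` and `𝔭·U = E·U + F·U` -/

/-- **`E·U := Σ_p E_p U`**, the span of the images of `U` under the root operators `E_p = E_{E_{ab}}` of `𝔭⁺` (★ `upqEOp`).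
[cite: BorelWallach2000, II §4.1–4.2] -/
def upqEStep (U : Submodule ℂ V) : Submodule ℂ V :=
  ⨆ p : α × β, U.map (upqEOp ρ𝔤 (Matrix.single p.1 p.2 (1 : ℂ)))

/-- **`F·U := Σ_p F_p U`**, the span of the images of `U` under the root operators `F_p = F_{E_{ba}}` of `𝔭⁻` (★ `upqFOp`).
[cite: BorelWallach2000, II §4.1–4.2] -/
def upqFStep (U : Submodule ℂ V) : Submodule ℂ V :=
  ⨆ p : α × β, U.map (upqFOp ρ𝔤 (Matrix.single p.2 p.1 (1 : ℂ)))

/-- **The bigraded level `M_{a,b} := F^b E^a W₀`** (`b` applications of `F·` after `a` applications of `E·`). [cite: Varadarajan1989, §5.3 (proof of Thm. 10)] -/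
def upqLevel (W₀ : Submodule ℂ V) (a b : ℕ) : Submodule ℂ V :=
  (upqFStep ρ𝔤)^[b] ((upqEStep ρ𝔤)^[a] W₀)

variable {ρ𝔤}

/-- `E_p u ∈ E·U`. [cite: BorelWallach2000, II §4.1] -/
theorem upqEOp_single_apply_mem_upqEStep {U : Submodule ℂ V} (p : α × β) {u : V} (hu : u ∈ U) :
    upqEOp ρ𝔤 (Matrix.single p.1 p.2 1) u ∈ upqEStep ρ𝔤 U :=
  Submodule.mem_iSup_of_mem p (Submodule.mem_map_of_mem hu)

/-- `F_p u ∈ F·U`. [cite: BorelWallach2000, II §4.1] -/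
theorem upqFOp_single_apply_mem_upqFStep {U : Submodule ℂ V} (p : α × β) {u : V} (hu : u ∈ U) :
    upqFOp ρ𝔤 (Matrix.single p.2 p.1 1) u ∈ upqFStep ρ𝔤 U :=
  Submodule.mem_iSup_of_mem p (Submodule.mem_map_of_mem hu)

/-- **`E_B u ∈ E·U` for every matrix `B`** (`E_B = Σ_p B_p E_p`). [cite: BorelWallach2000, II §4.1] -/
theorem upqEOp_apply_mem_upqEStep {U : Submodule ℂ V} (B : Matrix α β ℂ) {u : V} (hu : u ∈ U) : upqEOp ρ𝔤 B u ∈ upqEStep ρ𝔤 U := by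
  rw [Matrix.matrix_eq_sum_single B, map_sum, LinearMap.sum_apply]
  refine Submodule.sum_mem _ fun i _ => ?_
  rw [map_sum, LinearMap.sum_apply]
  refine Submodule.sum_mem _ fun j _ => ?_
  rw [show Matrix.single i j (B i j) = B i j • Matrix.single i j (1 : ℂ) by rw [Matrix.smul_single, smul_eq_mul, mul_one], map_smul,
    LinearMap.smul_apply]
  exact Submodule.smul_mem _ _ (upqEOp_single_apply_mem_upqEStep (i, j) hu)

/-- **`F_C u ∈ F·U` for every matrix `C`.** [cite: BorelWallach2000, II §4.1] -/
theorem upqFOp_apply_mem_upqFStep {U : Submodule ℂ V} (C : Matrix β α ℂ) {u : V} (hu : u ∈ U) : upqFOp ρ𝔤 C u ∈ upqFStep ρ𝔤 U := by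
  rw [Matrix.matrix_eq_sum_single C, map_sum, LinearMap.sum_apply]
  refine Submodule.sum_mem _ fun j _ => ?_
  rw [map_sum, LinearMap.sum_apply]
  refine Submodule.sum_mem _ fun i _ => ?_
  rw [show Matrix.single j i (C j i) = C j i • Matrix.single j i (1 : ℂ) by rw [Matrix.smul_single, smul_eq_mul, mul_one], map_smul,
    LinearMap.smul_apply]
  exact Submodule.smul_mem _ _ (upqFOp_single_apply_mem_upqFStep (i, j) hu)

/-- `E·U ≤ S` as soon as every generator `E_p u` (`u ∈ U`) lies in `S`. [cite: BorelWallach2000, II §4.1] -/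
theorem upqEStep_le {U S : Submodule ℂ V} (h : ∀ (p : α × β), ∀ u ∈ U, upqEOp ρ𝔤 (Matrix.single p.1 p.2 1) u ∈ S) :
    upqEStep ρ𝔤 U ≤ S :=
  iSup_le fun p => Submodule.map_le_iff_le_comap.mpr fun u hu => h p u hu

/-- `F·U ≤ S` as soon as every generator `F_p u` (`u ∈ U`) lies in `S`. [cite: BorelWallach2000, II §4.1] -/
theorem upqFStep_le {U S : Submodule ℂ V} (h : ∀ (p : α × β), ∀ u ∈ U, upqFOp ρ𝔤 (Matrix.single p.2 p.1 1) u ∈ S) :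
    upqFStep ρ𝔤 U ≤ S :=
  iSup_le fun p => Submodule.map_le_iff_le_comap.mpr fun u hu => h p u hu

/-- Mapping principle for `E·U`. [cite: BorelWallach2000, II §4.1] -/
theorem upqEStep_le_comap {U S : Submodule ℂ V} (T : V →ₗ[ℂ] V)
    (h : ∀ (p : α × β), ∀ u ∈ U, T (upqEOp ρ𝔤 (Matrix.single p.1 p.2 1) u) ∈ S) : upqEStep ρ𝔤 U ≤ S.comap T :=
  iSup_le fun p => Submodule.map_le_iff_le_comap.mpr fun u hu => h p u hu

/-- Mapping principle for `F·U`. [cite: BorelWallach2000, II §4.1] -/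
theorem upqFStep_le_comap {U S : Submodule ℂ V} (T : V →ₗ[ℂ] V)
    (h : ∀ (p : α × β), ∀ u ∈ U, T (upqFOp ρ𝔤 (Matrix.single p.2 p.1 1) u) ∈ S) : upqFStep ρ𝔤 U ≤ S.comap T :=
  iSup_le fun p => Submodule.map_le_iff_le_comap.mpr fun u hu => h p u hu

/-- `E·` is monotone. [cite: BorelWallach2000, II §4.1] -/
theorem upqEStep_mono {U U' : Submodule ℂ V} (h : U ≤ U') : upqEStep ρ𝔤 U ≤ upqEStep ρ𝔤 U' :=
  iSup_mono fun _ => Submodule.map_mono h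

/-- `F·` is monotone. [cite: BorelWallach2000, II §4.1] -/
theorem upqFStep_mono {U U' : Submodule ℂ V} (h : U ≤ U') : upqFStep ρ𝔤 U ≤ upqFStep ρ𝔤 U' :=
  iSup_mono fun _ => Submodule.map_mono h

/-- `E·(U + U') = E·U + E·U'`. [cite: BorelWallach2000, II §4.1] -/
theorem upqEStep_sup (U U' : Submodule ℂ V) : upqEStep ρ𝔤 (U ⊔ U') = upqEStep ρ𝔤 U ⊔ upqEStep ρ𝔤 U' := by
  simp only [upqEStep, Submodule.map_sup, iSup_sup_eq]

/-- `F·(U + U') = F·U + F·U'`. [cite: BorelWallach2000, II §4.1] -/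
theorem upqFStep_sup (U U' : Submodule ℂ V) : upqFStep ρ𝔤 (U ⊔ U') = upqFStep ρ𝔤 U ⊔ upqFStep ρ𝔤 U' := by
  simp only [upqFStep, Submodule.map_sup, iSup_sup_eq]

/-- `E·(⨆ U_i) = ⨆ E·U_i`. [cite: BorelWallach2000, II §4.1] -/
theorem upqEStep_iSup {ι : Sort*} (U : ι → Submodule ℂ V) : upqEStep ρ𝔤 (⨆ i, U i) = ⨆ i, upqEStep ρ𝔤 (U i) := by
  simp only [upqEStep, Submodule.map_iSup]
  rw [iSup_comm]

/-- `F·(⨆ U_i) = ⨆ F·U_i`. [cite: BorelWallach2000, II §4.1] -/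
theorem upqFStep_iSup {ι : Sort*} (U : ι → Submodule ℂ V) : upqFStep ρ𝔤 (⨆ i, U i) = ⨆ i, upqFStep ρ𝔤 (U i) := by
  simp only [upqFStep, Submodule.map_iSup]
  rw [iSup_comm]

/-- `E·⊥ = ⊥`. [cite: BorelWallach2000, II §4.1] -/
@[simp] theorem upqEStep_bot : upqEStep ρ𝔤 (⊥ : Submodule ℂ V) = ⊥ := by
  simp [upqEStep]

/-- `F·⊥ = ⊥`. [cite: BorelWallach2000, II §4.1] -/
@[simp] theorem upqFStep_bot : upqFStep ρ𝔤 (⊥ : Submodule ℂ V) = ⊥ := by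
  simp [upqFStep]

/-- `θ` in blocks: `θ [[A, B], [C, D']] = [[−Aᴴ, Cᴴ], [Bᴴ, −D'ᴴ]]`. [cite: Knapp2002, VI §2] -/
theorem upqTheta_fromBlocks (A : Matrix α α ℂ) (B : Matrix α β ℂ) (C : Matrix β α ℂ) (D' : Matrix β β ℂ) :
    upqTheta α β (Matrix.fromBlocks A B C D') = Matrix.fromBlocks (-Aᴴ) Cᴴ Bᴴ (-D'ᴴ) := by
  rw [upqTheta_apply, show signForm α β = Matrix.fromBlocks 1 0 0 (-1) from rfl, Matrix.fromBlocks_conjTranspose, Matrix.fromBlocks_multiply,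
    Matrix.fromBlocks_multiply]
  simp [Matrix.fromBlocks_neg]

/-- **`E_B u ∈ 𝔭·U`**: the real and imaginary parts of `e_B = [[0,B],[0,0]]` are the hermitian generators `½ X_B` and `X_{−iB/2}` of `𝔭`.
[cite: BorelWallach2000, II §1.1 (3), §4.1] -/
theorem upqEOp_apply_mem_upqPStep {U : Submodule ℂ V} (B : Matrix α β ℂ) {u : V} (hu : u ∈ U) : upqEOp ρ𝔤 B u ∈ upqPStep ρ𝔤 U := by
  rw [upqEOp_apply, upqLieC_apply, LinearMap.add_apply, LinearMap.smul_apply]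
  have hθ : upqTheta α β (Matrix.fromBlocks 0 B 0 0) = Matrix.fromBlocks 0 0 Bᴴ 0 := by
    rw [upqTheta_fromBlocks]; simp
  refine (upqPStep ρ𝔤 U).add_mem ?_ ((upqPStep ρ𝔤 U).smul_mem _ ?_)
  · refine apply_mem_upqPStep_of_mem_span (upq_mem_span_upqPBasis_of_toBlocks_eq_zero _ ?_ ?_) hu
    · rw [coe_upqRePart, hθ]
      simp only [Matrix.fromBlocks_add, Matrix.fromBlocks_smul, Matrix.toBlocks_fromBlocks₁₁, add_zero, smul_zero]
    · rw [coe_upqRePart, hθ]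
      simp only [Matrix.fromBlocks_add, Matrix.fromBlocks_smul, Matrix.toBlocks_fromBlocks₂₂, add_zero, smul_zero]
  · refine apply_mem_upqPStep_of_mem_span (upq_mem_span_upqPBasis_of_toBlocks_eq_zero _ ?_ ?_) hu
    · rw [coe_upqImPart, hθ]
      simp only [sub_eq_add_neg, Matrix.fromBlocks_neg, Matrix.fromBlocks_add, Matrix.fromBlocks_smul, Matrix.toBlocks_fromBlocks₁₁, neg_zero,
        add_zero, smul_zero]
    · rw [coe_upqImPart, hθ]
      simp only [sub_eq_add_neg, Matrix.fromBlocks_neg, Matrix.fromBlocks_add, Matrix.fromBlocks_smul, Matrix.toBlocks_fromBlocks₂₂, neg_zero,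
        add_zero, smul_zero]

/-- **`F_C u ∈ 𝔭·U`.** [cite: BorelWallach2000, II §1.1 (3), §4.1] -/
theorem upqFOp_apply_mem_upqPStep {U : Submodule ℂ V} (C : Matrix β α ℂ) {u : V} (hu : u ∈ U) : upqFOp ρ𝔤 C u ∈ upqPStep ρ𝔤 U := by
  rw [upqFOp_apply, upqLieC_apply, LinearMap.add_apply, LinearMap.smul_apply]
  have hθ : upqTheta α β (Matrix.fromBlocks 0 0 C 0) = Matrix.fromBlocks 0 Cᴴ 0 0 := by
    rw [upqTheta_fromBlocks]; simp
  refine (upqPStep ρ𝔤 U).add_mem ?_ ((upqPStep ρ𝔤 U).smul_mem _ ?_)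
  · refine apply_mem_upqPStep_of_mem_span (upq_mem_span_upqPBasis_of_toBlocks_eq_zero _ ?_ ?_) hu
    · rw [coe_upqRePart, hθ]
      simp only [Matrix.fromBlocks_add, Matrix.fromBlocks_smul, Matrix.toBlocks_fromBlocks₁₁, add_zero, smul_zero]
    · rw [coe_upqRePart, hθ]
      simp only [Matrix.fromBlocks_add, Matrix.fromBlocks_smul, Matrix.toBlocks_fromBlocks₂₂, add_zero, smul_zero]
  · refine apply_mem_upqPStep_of_mem_span (upq_mem_span_upqPBasis_of_toBlocks_eq_zero _ ?_ ?_) hu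
    · rw [coe_upqImPart, hθ]
      simp only [sub_eq_add_neg, Matrix.fromBlocks_neg, Matrix.fromBlocks_add, Matrix.fromBlocks_smul, Matrix.toBlocks_fromBlocks₁₁, neg_zero,
        add_zero, smul_zero]
    · rw [coe_upqImPart, hθ]
      simp only [sub_eq_add_neg, Matrix.fromBlocks_neg, Matrix.fromBlocks_add, Matrix.fromBlocks_smul, Matrix.toBlocks_fromBlocks₂₂, neg_zero,
        add_zero, smul_zero]

/-- `E·U ≤ 𝔭·U`. [cite: BorelWallach2000, II §4.1] -/
theorem upqEStep_le_upqPStep (U : Submodule ℂ V) : upqEStep ρ𝔤 U ≤ upqPStep ρ𝔤 U :=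
  iSup_le fun _ => Submodule.map_le_iff_le_comap.mpr fun _ hu => upqEOp_apply_mem_upqPStep _ hu

/-- `F·U ≤ 𝔭·U`. [cite: BorelWallach2000, II §4.1] -/
theorem upqFStep_le_upqPStep (U : Submodule ℂ V) : upqFStep ρ𝔤 U ≤ upqPStep ρ𝔤 U :=
  iSup_le fun _ => Submodule.map_le_iff_le_comap.mpr fun _ hu => upqFOp_apply_mem_upqPStep _ hu

/-- `ρ𝔤(x_s) u ∈ E·U + F·U` (`ρ𝔤(X_{cE_p}) = c E_p + c̄ F_p`, ★ `ρ𝔤_upqUnit_eq`). [cite: BorelWallach2000, II §1.1 (5), §4.1] -/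
theorem apply_upqPBasis_mem_upqEStep_sup_upqFStep {U : Submodule ℂ V} (s : (α × β) × Fin 2) {u : V} (hu : u ∈ U) :
    ρ𝔤 (upqPBasis s) u ∈ upqEStep ρ𝔤 U ⊔ upqFStep ρ𝔤 U := by
  rw [show (upqPBasis s : (uFormGroup α β).lie) = upqUnit s.1 (upqPCoeff s.2) from rfl, ρ𝔤_upqUnit_eq, LinearMap.add_apply,
    LinearMap.smul_apply, LinearMap.smul_apply]
  exact Submodule.add_mem_sup (Submodule.smul_mem _ _ (upqEOp_single_apply_mem_upqEStep s.1 hu))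
    (Submodule.smul_mem _ _ (upqFOp_single_apply_mem_upqFStep s.1 hu))

variable (ρ𝔤) in
/-- **`𝔭·U = E·U + F·U`.** [cite: BorelWallach2000, II §4.1–4.2] -/
theorem upqPStep_eq_upqEStep_sup_upqFStep (U : Submodule ℂ V) : upqPStep ρ𝔤 U = upqEStep ρ𝔤 U ⊔ upqFStep ρ𝔤 U := by
  refine le_antisymm (iSup_le fun s => Submodule.map_le_iff_le_comap.mpr fun u hu => apply_upqPBasis_mem_upqEStep_sup_upqFStep s hu) ?_
  exact sup_le (upqEStep_le_upqPStep U) (upqFStep_le_upqPStep U)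

/-- `E·U` is finite-dimensional when `U` is. [cite: Varadarajan1989, §5.3 (proof of Thm. 10)] -/
theorem finiteDimensional_upqEStep (U : Submodule ℂ V) [FiniteDimensional ℂ U] : FiniteDimensional ℂ (upqEStep ρ𝔤 U) := by
  unfold upqEStep; infer_instance

/-- `F·U` is finite-dimensional when `U` is. [cite: Varadarajan1989, §5.3 (proof of Thm. 10)] -/
theorem finiteDimensional_upqFStep (U : Submodule ℂ V) [FiniteDimensional ℂ U] : FiniteDimensional ℂ (upqFStep ρ𝔤 U) := by
  unfold upqFStep; infer_instance

/-! ## §2 `K`-stability and the commutation `E·(F·U) ⊆ F·(E·U) + U` -/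

/-- **`E·U` is `K`-stable when `U` is** (`ρK(k) E_p ρK(k)⁻¹ = E_{k₁ E_p k₂ᴴ}`, ★ `ρK_upqEOp_apply`). [cite: BorelWallach2000, VI 4.8 (3)] -/
theorem upqEStep_kStable (hV : IsGKModule (uFormGroup α β) ρK ρ𝔤) {U : Submodule ℂ V}
    (hU : ∀ (k : (uFormGroup α β).maximalCompact), ∀ u ∈ U, ρK k u ∈ U) (k : (uFormGroup α β).maximalCompact) {x : V}
    (hx : x ∈ upqEStep ρ𝔤 U) : ρK k x ∈ upqEStep ρ𝔤 U := by
  refine upqEStep_le_comap (S := upqEStep ρ𝔤 U) (ρK k) (fun p u hu => ?_) hx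
  rw [ρK_upqEOp_apply ρK ρ𝔤 hV]
  exact upqEOp_apply_mem_upqEStep _ (hU k u hu)

/-- **`F·U` is `K`-stable when `U` is.** [cite: BorelWallach2000, VI 4.8 (3)] -/
theorem upqFStep_kStable (hV : IsGKModule (uFormGroup α β) ρK ρ𝔤) {U : Submodule ℂ V}
    (hU : ∀ (k : (uFormGroup α β).maximalCompact), ∀ u ∈ U, ρK k u ∈ U) (k : (uFormGroup α β).maximalCompact) {x : V}
    (hx : x ∈ upqFStep ρ𝔤 U) : ρK k x ∈ upqFStep ρ𝔤 U := by
  refine upqFStep_le_comap (S := upqFStep ρ𝔤 U) (ρK k) (fun p u hu => ?_) hx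
  rw [ρK_upqFOp_apply ρK ρ𝔤 hV]
  exact upqFOp_apply_mem_upqFStep _ (hU k u hu)

/-- Iterates of `E·` preserve `K`-stability. [cite: BorelWallach2000, VI 4.8 (3)] -/
theorem iterate_upqEStep_kStable (hV : IsGKModule (uFormGroup α β) ρK ρ𝔤) {U : Submodule ℂ V}
    (hU : ∀ (k : (uFormGroup α β).maximalCompact), ∀ u ∈ U, ρK k u ∈ U) (a : ℕ) (k : (uFormGroup α β).maximalCompact) {x : V}
    (hx : x ∈ (upqEStep ρ𝔤)^[a] U) : ρK k x ∈ (upqEStep ρ𝔤)^[a] U := by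
  induction a generalizing k x with
  | zero => exact hU k x hx
  | succ a ih =>
    rw [Function.iterate_succ_apply'] at hx ⊢
    exact upqEStep_kStable ρK hV (fun k u hu => ih k hu) k hx

/-- Iterates of `F·` preserve `K`-stability. [cite: BorelWallach2000, VI 4.8 (3)] -/
theorem iterate_upqFStep_kStable (hV : IsGKModule (uFormGroup α β) ρK ρ𝔤) {U : Submodule ℂ V}
    (hU : ∀ (k : (uFormGroup α β).maximalCompact), ∀ u ∈ U, ρK k u ∈ U) (b : ℕ) (k : (uFormGroup α β).maximalCompact) {x : V}
    (hx : x ∈ (upqFStep ρ𝔤)^[b] U) : ρK k x ∈ (upqFStep ρ𝔤)^[b] U := by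
  induction b generalizing k x with
  | zero => exact hU k x hx
  | succ b ih =>
    rw [Function.iterate_succ_apply'] at hx ⊢
    exact upqFStep_kStable ρK hV (fun k u hu => ih k hu) k hx

/-- **Every level `M_{a,b}` is `K`-stable when `W₀` is.** [cite: Varadarajan1989, §5.3 (proof of Thm. 10)] -/
theorem upqLevel_kStable (hV : IsGKModule (uFormGroup α β) ρK ρ𝔤) {W₀ : Submodule ℂ V}
    (hW₀ : ∀ (k : (uFormGroup α β).maximalCompact), ∀ w ∈ W₀, ρK k w ∈ W₀) (a b : ℕ) (k : (uFormGroup α β).maximalCompact) {x : V}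
    (hx : x ∈ upqLevel ρ𝔤 W₀ a b) : ρK k x ∈ upqLevel ρ𝔤 W₀ a b :=
  iterate_upqFStep_kStable ρK hV (fun k _ hu => iterate_upqEStep_kStable ρK hV hW₀ a k hu) b k hx

/-- Iterates of `E·` preserve finite-dimensionality. [cite: Varadarajan1989, §5.3 (proof of Thm. 10)] -/
theorem finiteDimensional_iterate_upqEStep (U : Submodule ℂ V) [FiniteDimensional ℂ U] (a : ℕ) :
    FiniteDimensional ℂ ((upqEStep ρ𝔤)^[a] U) := by
  induction a with
  | zero => exact (inferInstance : FiniteDimensional ℂ U)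
  | succ a ih => rw [Function.iterate_succ_apply']; exact finiteDimensional_upqEStep _

/-- Iterates of `F·` preserve finite-dimensionality. [cite: Varadarajan1989, §5.3 (proof of Thm. 10)] -/
theorem finiteDimensional_iterate_upqFStep (U : Submodule ℂ V) [FiniteDimensional ℂ U] (b : ℕ) :
    FiniteDimensional ℂ ((upqFStep ρ𝔤)^[b] U) := by
  induction b with
  | zero => exact (inferInstance : FiniteDimensional ℂ U)
  | succ b ih => rw [Function.iterate_succ_apply']; exact finiteDimensional_upqFStep _

/-- **Every level `M_{a,b}` is finite-dimensional when `W₀` is.** [cite: Varadarajan1989, §5.3 (proof of Thm. 10)] -/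
theorem finiteDimensional_upqLevel (W₀ : Submodule ℂ V) [FiniteDimensional ℂ W₀] (a b : ℕ) : FiniteDimensional ℂ (upqLevel ρ𝔤 W₀ a b) := by
  haveI := finiteDimensional_iterate_upqEStep (ρ𝔤 := ρ𝔤) W₀ a
  exact finiteDimensional_iterate_upqFStep _ b

/-- **`E·(F·U) ⊆ F·(E·U) + U` for `K`-stable `U`**: `E_p F_q u = F_q E_p u + [E_p, F_q] u` with `[E_p, F_q] ∈ ρ_ℂ(𝔨_ℂ)` preserving the
`𝔨`-stable subspace `U` (★ `upqEOp_mul_upqFOp_sub_apply_mem`). [cite: BorelWallach2000, II §1.1 (4), §4.2] -/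
theorem upqEStep_upqFStep_le (hV : IsGKModule (uFormGroup α β) ρK ρ𝔤) {U : Submodule ℂ V}
    (hU : ∀ (k : (uFormGroup α β).maximalCompact), ∀ u ∈ U, ρK k u ∈ U) :
    upqEStep ρ𝔤 (upqFStep ρ𝔤 U) ≤ upqFStep ρ𝔤 (upqEStep ρ𝔤 U) ⊔ U := by
  have hU' : ∀ Y ∈ (uFormGroup α β).kInLie, ∀ u ∈ U, ρ𝔤 Y u ∈ U := fun _ hY _ hu => apply_mem_of_K_stable_of_mem_kInLie ρK hV hU hY hu
  refine upqEStep_le fun p y hy => ?_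
  refine upqFStep_le_comap (S := upqFStep ρ𝔤 (upqEStep ρ𝔤 U) ⊔ U) (upqEOp ρ𝔤 (Matrix.single p.1 p.2 1)) (fun q u hu => ?_) hy
  have hsplit : upqEOp ρ𝔤 (Matrix.single p.1 p.2 1) (upqFOp ρ𝔤 (Matrix.single q.2 q.1 1) u) =
      upqFOp ρ𝔤 (Matrix.single q.2 q.1 1) (upqEOp ρ𝔤 (Matrix.single p.1 p.2 1) u) +
        (upqEOp ρ𝔤 (Matrix.single p.1 p.2 1) * upqFOp ρ𝔤 (Matrix.single q.2 q.1 1) -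
          upqFOp ρ𝔤 (Matrix.single q.2 q.1 1) * upqEOp ρ𝔤 (Matrix.single p.1 p.2 1)) u := by
    rw [LinearMap.sub_apply, Module.End.mul_apply, Module.End.mul_apply, add_sub_cancel]
  rw [hsplit]
  exact Submodule.add_mem_sup (upqFOp_single_apply_mem_upqFStep q (upqEOp_single_apply_mem_upqEStep p hu))
    (upqEOp_mul_upqFOp_sub_apply_mem ρ𝔤 _ _ hU' hu)

/-- **`E·(F^b X) ⊆ F^b(E·X) + Σ_{j<b} F^j X` for `K`-stable `X`** (induction on `b` with §2). [cite: Varadarajan1989, §5.3 (proof of Thm. 10)] -/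
theorem upqEStep_iterate_upqFStep_le (hV : IsGKModule (uFormGroup α β) ρK ρ𝔤) {X : Submodule ℂ V}
    (hX : ∀ (k : (uFormGroup α β).maximalCompact), ∀ x ∈ X, ρK k x ∈ X) (b : ℕ) :
    upqEStep ρ𝔤 ((upqFStep ρ𝔤)^[b] X) ≤ (upqFStep ρ𝔤)^[b] (upqEStep ρ𝔤 X) ⊔ ⨆ (j : ℕ) (_ : j < b), (upqFStep ρ𝔤)^[j] X := by
  induction b with
  | zero => simp
  | succ b ih =>
    rw [Function.iterate_succ_apply', Function.iterate_succ_apply']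
    calc upqEStep ρ𝔤 (upqFStep ρ𝔤 ((upqFStep ρ𝔤)^[b] X))
        ≤ upqFStep ρ𝔤 (upqEStep ρ𝔤 ((upqFStep ρ𝔤)^[b] X)) ⊔ (upqFStep ρ𝔤)^[b] X :=
          upqEStep_upqFStep_le ρK hV (iterate_upqFStep_kStable ρK hV hX b)
      _ ≤ upqFStep ρ𝔤 ((upqFStep ρ𝔤)^[b] (upqEStep ρ𝔤 X) ⊔ ⨆ (j : ℕ) (_ : j < b), (upqFStep ρ𝔤)^[j] X) ⊔ (upqFStep ρ𝔤)^[b] X :=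
          sup_le_sup_right (upqFStep_mono ih) _
      _ ≤ upqFStep ρ𝔤 ((upqFStep ρ𝔤)^[b] (upqEStep ρ𝔤 X)) ⊔ ⨆ (j : ℕ) (_ : j < b + 1), (upqFStep ρ𝔤)^[j] X := by
          rw [upqFStep_sup, upqFStep_iSup, sup_assoc]
          refine sup_le_sup_left (sup_le (iSup_le fun j => ?_) ?_) _
          · rw [upqFStep_iSup]
            refine iSup_le fun hj => ?_
            rw [← Function.iterate_succ_apply' (upqFStep ρ𝔤) j X]
            exact le_iSup₂_of_le (j + 1) (Nat.succ_lt_succ hj) le_rfl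
          · exact le_iSup₂_of_le b (Nat.lt_succ_self b) le_rfl

/-! ## §3 `F_n = Σ_{a+b ≤ n} M_{a,b}` -/

/-- `E·F_m ⊆ F_{m+1}` for the `𝔭`-filtration. [cite: Varadarajan1989, §5.3 (proof of Thm. 10)] -/
theorem upqEStep_upqPFiltration_le (W₀ : Submodule ℂ V) (m : ℕ) : upqEStep ρ𝔤 (upqPFiltration ρ𝔤 W₀ m) ≤ upqPFiltration ρ𝔤 W₀ (m + 1) :=
  (upqEStep_le_upqPStep _).trans (upqPStep_upqPFiltration_le ρ𝔤 W₀ m)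

/-- `F·F_m ⊆ F_{m+1}` for the `𝔭`-filtration. [cite: Varadarajan1989, §5.3 (proof of Thm. 10)] -/
theorem upqFStep_upqPFiltration_le (W₀ : Submodule ℂ V) (m : ℕ) : upqFStep ρ𝔤 (upqPFiltration ρ𝔤 W₀ m) ≤ upqPFiltration ρ𝔤 W₀ (m + 1) :=
  (upqFStep_le_upqPStep _).trans (upqPStep_upqPFiltration_le ρ𝔤 W₀ m)

/-- `E^a W₀ ⊆ F_a`. [cite: Varadarajan1989, §5.3 (proof of Thm. 10)] -/
theorem iterate_upqEStep_le_upqPFiltration (W₀ : Submodule ℂ V) (a : ℕ) : (upqEStep ρ𝔤)^[a] W₀ ≤ upqPFiltration ρ𝔤 W₀ a := by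
  induction a with
  | zero => simp
  | succ a ih =>
    rw [Function.iterate_succ_apply']
    exact (upqEStep_mono ih).trans (upqEStep_upqPFiltration_le W₀ a)

/-- `M_{a,b+1} = F·M_{a,b}`. [cite: Varadarajan1989, §5.3 (proof of Thm. 10)] -/
theorem upqLevel_succ_right (W₀ : Submodule ℂ V) (a b : ℕ) : upqLevel ρ𝔤 W₀ a (b + 1) = upqFStep ρ𝔤 (upqLevel ρ𝔤 W₀ a b) :=
  Function.iterate_succ_apply' _ _ _

/-- `M_{a,0} = E^a W₀` and `M_{a+1,0} = E·M_{a,0}`. [cite: Varadarajan1989, §5.3 (proof of Thm. 10)] -/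
theorem upqLevel_succ_left_zero (W₀ : Submodule ℂ V) (a : ℕ) : upqLevel ρ𝔤 W₀ (a + 1) 0 = upqEStep ρ𝔤 (upqLevel ρ𝔤 W₀ a 0) :=
  Function.iterate_succ_apply' _ _ _

/-- `M_{0,0} = W₀`. [cite: Varadarajan1989, §5.3 (proof of Thm. 10)] -/
@[simp] theorem upqLevel_zero_zero (W₀ : Submodule ℂ V) : upqLevel ρ𝔤 W₀ 0 0 = W₀ := rfl

/-- **`M_{a,b} ⊆ F_{a+b}`.** [cite: Varadarajan1989, §5.3 (proof of Thm. 10)] -/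
theorem upqLevel_le_upqPFiltration (W₀ : Submodule ℂ V) (a b : ℕ) : upqLevel ρ𝔤 W₀ a b ≤ upqPFiltration ρ𝔤 W₀ (a + b) := by
  induction b with
  | zero => simpa [upqLevel] using iterate_upqEStep_le_upqPFiltration (ρ𝔤 := ρ𝔤) W₀ a
  | succ b ih =>
    rw [upqLevel_succ_right, show a + (b + 1) = (a + b) + 1 by ring]
    exact (upqFStep_mono ih).trans (upqFStep_upqPFiltration_le W₀ (a + b))

/-- `E·M_{a,b} ⊆ M_{a+1,b} + Σ_{j<b} M_{a,j}` for `K`-stable `W₀`. [cite: Varadarajan1989, §5.3 (proof of Thm. 10)] -/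
theorem upqEStep_upqLevel_le (hV : IsGKModule (uFormGroup α β) ρK ρ𝔤) {W₀ : Submodule ℂ V}
    (hW₀ : ∀ (k : (uFormGroup α β).maximalCompact), ∀ w ∈ W₀, ρK k w ∈ W₀) (a b : ℕ) :
    upqEStep ρ𝔤 (upqLevel ρ𝔤 W₀ a b) ≤ upqLevel ρ𝔤 W₀ (a + 1) b ⊔ ⨆ (j : ℕ) (_ : j < b), upqLevel ρ𝔤 W₀ a j := by
  have h := upqEStep_iterate_upqFStep_le ρK hV (X := (upqEStep ρ𝔤)^[a] W₀) (iterate_upqEStep_kStable ρK hV hW₀ a) b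
  simpa only [upqLevel, Function.iterate_succ_apply'] using h

/-- **`F_n = Σ_{a+b ≤ n} M_{a,b}`** — the `𝔭`-filtration of N1 is the sum of the bigraded levels, for `K`-stable `W₀` (the `(𝔤, K)`-axioms give the
commutation `E·F· ⊆ F·E· + 𝔨`-part). [cite: Varadarajan1989, §5.3 (proof of Thm. 10)] [cite: BorelWallach2000, II §4.2] -/
theorem upqPFiltration_eq_iSup_upqLevel (hV : IsGKModule (uFormGroup α β) ρK ρ𝔤) {W₀ : Submodule ℂ V}
    (hW₀ : ∀ (k : (uFormGroup α β).maximalCompact), ∀ w ∈ W₀, ρK k w ∈ W₀) (n : ℕ) :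
    upqPFiltration ρ𝔤 W₀ n = ⨆ (a : ℕ) (b : ℕ) (_ : a + b ≤ n), upqLevel ρ𝔤 W₀ a b := by
  apply le_antisymm
  · induction n with
    | zero =>
      rw [upqPFiltration_zero]
      exact le_iSup₂_of_le 0 0 (le_iSup_of_le (le_refl 0) (by simp))
    | succ n ih =>
      -- abbreviation for the right-hand sides
      have hmono : (⨆ (a : ℕ) (b : ℕ) (_ : a + b ≤ n), upqLevel ρ𝔤 W₀ a b) ≤ ⨆ (a : ℕ) (b : ℕ) (_ : a + b ≤ n + 1), upqLevel ρ𝔤 W₀ a b :=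
        iSup₂_mono fun a b => iSup_mono' fun h => ⟨h.trans n.le_succ, le_rfl⟩
      rw [upqPFiltration_succ, upqPStep_eq_upqEStep_sup_upqFStep]
      refine sup_le (ih.trans hmono) (sup_le ?_ ?_)
      · refine (upqEStep_mono ih).trans ?_
        rw [upqEStep_iSup]
        refine iSup_le fun a => ?_
        rw [upqEStep_iSup]
        refine iSup_le fun b => ?_
        rw [upqEStep_iSup]
        refine iSup_le fun hab => ?_
        refine (upqEStep_upqLevel_le ρK hV hW₀ a b).trans (sup_le ?_ ?_)
        · exact le_iSup₂_of_le (a + 1) b (le_iSup_of_le (by omega) le_rfl)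
        · exact iSup₂_le fun j hj => le_iSup₂_of_le a j (le_iSup_of_le (by omega) le_rfl)
      · refine (upqFStep_mono ih).trans ?_
        rw [upqFStep_iSup]
        refine iSup_le fun a => ?_
        rw [upqFStep_iSup]
        refine iSup_le fun b => ?_
        rw [upqFStep_iSup]
        refine iSup_le fun hab => ?_
        rw [← upqLevel_succ_right]
        exact le_iSup₂_of_le a (b + 1) (le_iSup_of_le (by omega) le_rfl)
  · exact iSup₂_le fun a b => iSup_le fun hab => (upqLevel_le_upqPFiltration W₀ a b).trans (monotone_upqPFiltration ρ𝔤 W₀ hab)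

/-- Consequently **`⨆_{a,b} M_{a,b} = ⊤` for an irreducible module and a non-zero `K`-stable `W₀`** (exhaustion, N1 ★ `iSup_upqPFiltration_eq_top`).
[cite: Varadarajan1989, §5.3 (proof of Thm. 10)] -/
theorem iSup_upqLevel_eq_top (hV : IsGKModule (uFormGroup α β) ρK ρ𝔤) (hirr : IsIrreducibleGK ρK ρ𝔤) {W₀ : Submodule ℂ V}
    (hW₀ : ∀ (k : (uFormGroup α β).maximalCompact), ∀ w ∈ W₀, ρK k w ∈ W₀) (hW₀ne : W₀ ≠ ⊥) :
    ⨆ (a : ℕ) (b : ℕ), upqLevel ρ𝔤 W₀ a b = ⊤ := by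
  refine top_le_iff.mp ?_
  rw [← iSup_upqPFiltration_eq_top ρK hV hirr hW₀ hW₀ne]
  refine iSup_le fun n => ?_
  rw [upqPFiltration_eq_iSup_upqLevel ρK hV hW₀ n]
  exact iSup₂_le fun a b => iSup_le fun _ => le_iSup₂_of_le a b le_rfl

/-! ## §4 `z₀`-weights of the levels -/

/-- `E·` shifts `ρ𝔤(z₀)`-eigenvalues by `+i`. [cite: BorelWallach2000, II §4.1] -/
theorem upqEStep_le_eigenspace {U : Submodule ℂ V} {ν : ℂ} (hU : U ≤ (ρ𝔤 (upqZ0 α β)).eigenspace ν) :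
    upqEStep ρ𝔤 U ≤ (ρ𝔤 (upqZ0 α β)).eigenspace (ν + Complex.I) := by
  refine iSup_le fun p => Submodule.map_le_iff_le_comap.mpr fun u hu => ?_
  have hu' := Module.End.mem_eigenspace_iff.mp (hU hu)
  change upqEOp ρ𝔤 (Matrix.single p.1 p.2 1) u ∈ (ρ𝔤 (upqZ0 α β)).eigenspace (ν + Complex.I)
  rw [Module.End.mem_eigenspace_iff]
  have h := LinearMap.congr_fun (ρ𝔤_upqZ0_mul_upqEOp_sub ρ𝔤 (Matrix.single p.1 p.2 (1 : ℂ))) u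
  simp only [LinearMap.sub_apply, Module.End.mul_apply, LinearMap.smul_apply] at h
  rw [sub_eq_iff_eq_add] at h
  rw [h, hu', map_smul, add_smul, add_comm]

/-- `F·` shifts `ρ𝔤(z₀)`-eigenvalues by `−i`. [cite: BorelWallach2000, II §4.1] -/
theorem upqFStep_le_eigenspace {U : Submodule ℂ V} {ν : ℂ} (hU : U ≤ (ρ𝔤 (upqZ0 α β)).eigenspace ν) :
    upqFStep ρ𝔤 U ≤ (ρ𝔤 (upqZ0 α β)).eigenspace (ν - Complex.I) := by
  refine iSup_le fun p => Submodule.map_le_iff_le_comap.mpr fun u hu => ?_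
  have hu' := Module.End.mem_eigenspace_iff.mp (hU hu)
  change upqFOp ρ𝔤 (Matrix.single p.2 p.1 1) u ∈ (ρ𝔤 (upqZ0 α β)).eigenspace (ν - Complex.I)
  rw [Module.End.mem_eigenspace_iff]
  have h := LinearMap.congr_fun (ρ𝔤_upqZ0_mul_upqFOp_sub ρ𝔤 (Matrix.single p.2 p.1 (1 : ℂ))) u
  simp only [LinearMap.sub_apply, Module.End.mul_apply, LinearMap.neg_apply, LinearMap.smul_apply] at h
  rw [sub_eq_iff_eq_add] at h
  rw [h, hu', map_smul, sub_smul, neg_add_eq_sub]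

/-- **`z₀`-WEIGHTS OF THE LEVELS**: if `ρ𝔤(z₀)` acts on `W₀` by the scalar `μ`, then it acts on `M_{a,b}` by `μ + i (a − b)`.
[cite: BorelWallach2000, II §4.1] [cite: Varadarajan1989, §5.4] -/
theorem upqLevel_le_eigenspace {W₀ : Submodule ℂ V} {μ : ℂ} (hW₀ : W₀ ≤ (ρ𝔤 (upqZ0 α β)).eigenspace μ) (a b : ℕ) :
    upqLevel ρ𝔤 W₀ a b ≤ (ρ𝔤 (upqZ0 α β)).eigenspace (μ + Complex.I * ((a : ℂ) - (b : ℂ))) := by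
  have hE : ∀ a : ℕ, (upqEStep ρ𝔤)^[a] W₀ ≤ (ρ𝔤 (upqZ0 α β)).eigenspace (μ + Complex.I * (a : ℂ)) := by
    intro a
    induction a with
    | zero => simpa using hW₀
    | succ a ih =>
      rw [Function.iterate_succ_apply']
      convert upqEStep_le_eigenspace ih using 2
      push_cast; ring
  induction b with
  | zero => simpa [upqLevel] using hE a
  | succ b ih =>
    rw [upqLevel_succ_right]
    convert upqFStep_le_eigenspace ih using 2
    push_cast; ring

/-- Pointwise form: `ρ𝔤(z₀) v = (μ + i(a − b)) v` on `M_{a,b}`. [cite: BorelWallach2000, II §4.1] -/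
theorem ρ𝔤_upqZ0_apply_of_mem_upqLevel {W₀ : Submodule ℂ V} {μ : ℂ} (hW₀ : ∀ w ∈ W₀, ρ𝔤 (upqZ0 α β) w = μ • w) (a b : ℕ) {v : V}
    (hv : v ∈ upqLevel ρ𝔤 W₀ a b) : ρ𝔤 (upqZ0 α β) v = (μ + Complex.I * ((a : ℂ) - (b : ℂ))) • v :=
  Module.End.mem_eigenspace_iff.mp (upqLevel_le_eigenspace (fun w hw => Module.End.mem_eigenspace_iff.mpr (hW₀ w hw)) a b hv)

/-! ## §5 The `q`-reduction: `Σ_s ρ𝔤(x_s)² = Σ_p (E_p F_p + F_p E_p)` preserves `K`-stable subspaces -/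

/-- **`Σ_s ρ𝔤(x_s)² = Σ_p (E_p F_p + F_p E_p)`** for the `B`-orthonormal frame `x_{p,k} = X_{c_k E_p}`, `c₀ = (1+i)/2`, `c₁ = (1−i)/2` of ★ `upqPBasis`
(`c₀² + c₁² = 0`, `|c₀|² + |c₁|² = 1`). [cite: BorelWallach2000, II §1.1 (5), II 1.3 (1)] -/
theorem upq_sum_ρ𝔤_upqPBasis_mul_self_eq :
    (∑ s : (α × β) × Fin 2, ρ𝔤 (upqPBasis s) * ρ𝔤 (upqPBasis s)) =
      ∑ p : α × β, (upqEOp ρ𝔤 (Matrix.single p.1 p.2 1) * upqFOp ρ𝔤 (Matrix.single p.2 p.1 1) +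
        upqFOp ρ𝔤 (Matrix.single p.2 p.1 1) * upqEOp ρ𝔤 (Matrix.single p.1 p.2 1)) := by
  rw [Fintype.sum_prod_type]
  refine Finset.sum_congr rfl fun p _ => ?_
  rw [Fin.sum_univ_two, show (upqPBasis (p, (0 : Fin 2)) : (uFormGroup α β).lie) = upqUnit p (upqPCoeff 0) from rfl,
    show (upqPBasis (p, (1 : Fin 2)) : (uFormGroup α β).lie) = upqUnit p (upqPCoeff 1) from rfl, ρ𝔤_upqUnit_eq, ρ𝔤_upqUnit_eq]
  set E := upqEOp ρ𝔤 (Matrix.single p.1 p.2 (1 : ℂ))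
  set F := upqFOp ρ𝔤 (Matrix.single p.2 p.1 (1 : ℂ))
  have hc0 : conj (upqPCoeff 0) = upqPCoeff 1 := by
    simp only [upqPCoeff, Fin.isValue, ↓reduceIte, one_ne_zero, map_div₀, map_add, map_one, Complex.conj_I, map_ofNat]
    ring
  have hc1 : conj (upqPCoeff 1) = upqPCoeff 0 := by
    simp only [upqPCoeff, Fin.isValue, ↓reduceIte, one_ne_zero, map_div₀, map_sub, map_one, Complex.conj_I, map_ofNat]
    ring
  rw [hc0, hc1]
  have hsq : upqPCoeff 0 * upqPCoeff 0 + upqPCoeff 1 * upqPCoeff 1 = 0 := by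
    simp only [upqPCoeff, Fin.isValue, ↓reduceIte, one_ne_zero]
    ring_nf; rw [Complex.I_sq]; ring
  have hmix : upqPCoeff 0 * upqPCoeff 1 + upqPCoeff 1 * upqPCoeff 0 = 1 := by
    simp only [upqPCoeff, Fin.isValue, ↓reduceIte, one_ne_zero]
    ring_nf; rw [Complex.I_sq]; ring
  have hEE : (upqPCoeff 0 * upqPCoeff 0 + upqPCoeff 1 * upqPCoeff 1) • (E * E) = 0 := by rw [hsq, zero_smul]
  have hFF : (upqPCoeff 1 * upqPCoeff 1 + upqPCoeff 0 * upqPCoeff 0) • (F * F) = 0 := by rw [add_comm, hsq, zero_smul]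
  have hEF : (upqPCoeff 0 * upqPCoeff 1 + upqPCoeff 1 * upqPCoeff 0) • (E * F) = E * F := by rw [hmix, one_smul]
  have hFE : (upqPCoeff 1 * upqPCoeff 0 + upqPCoeff 0 * upqPCoeff 1) • (F * E) = F * E := by rw [add_comm, hmix, one_smul]
  simp only [mul_add, add_mul, smul_mul_assoc, mul_smul_comm]
  linear_combination (norm := module) hEE + hFF + hEF + hFE

/-- **`q`-REDUCTION (commutator form)**: `Σ_p (E_p F_p − F_p E_p)` preserves every `𝔨`-stable subspace (`[E_p, F_p] ∈ ρ_ℂ(𝔨_ℂ)`).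
[cite: BorelWallach2000, II §1.1 (4)] -/
theorem upq_sum_upqEOp_upqFOp_sub_apply_mem {U : Submodule ℂ V} (hU : ∀ Y ∈ (uFormGroup α β).kInLie, ∀ u ∈ U, ρ𝔤 Y u ∈ U) {u : V} (hu : u ∈ U) :
    (∑ p : α × β, (upqEOp ρ𝔤 (Matrix.single p.1 p.2 1) * upqFOp ρ𝔤 (Matrix.single p.2 p.1 1) -
        upqFOp ρ𝔤 (Matrix.single p.2 p.1 1) * upqEOp ρ𝔤 (Matrix.single p.1 p.2 1))) u ∈ U := by
  rw [LinearMap.sum_apply]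
  exact Submodule.sum_mem _ fun p _ => upqEOp_mul_upqFOp_sub_apply_mem ρ𝔤 _ _ hU hu

/-- **`q`-REDUCTION**: if the Casimir acts by a scalar, `Σ_p F_p E_p` preserves every `K`-stable subspace (N2 ★ `upq_sum_pPart_mem_of_kStable_of_casimir`
+ `Σ_s ρ𝔤(x_s)² = Σ_p (E_p F_p + F_p E_p)` + the commutator form). [cite: Varadarajan1989, §5.4 (proof of Thm. 22)] [cite: BorelWallach2000, II §4.2] -/
theorem upq_sum_upqFOp_upqEOp_apply_mem_of_casimir (hV : IsGKModule (uFormGroup α β) ρK ρ𝔤) {c : ℂ}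
    (hC : upqCasimirOp ρ𝔤 = algebraMap ℂ (Module.End ℂ V) c) {U : Submodule ℂ V}
    (hU : ∀ (k : (uFormGroup α β).maximalCompact), ∀ u ∈ U, ρK k u ∈ U) {u : V} (hu : u ∈ U) :
    (∑ p : α × β, upqFOp ρ𝔤 (Matrix.single p.2 p.1 1) (upqEOp ρ𝔤 (Matrix.single p.1 p.2 1) u)) ∈ U := by
  have hU' : ∀ Y ∈ (uFormGroup α β).kInLie, ∀ u ∈ U, ρ𝔤 Y u ∈ U := fun _ hY _ hu => apply_mem_of_K_stable_of_mem_kInLie ρK hV hU hY hu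
  -- `Σ_p (E_p F_p + F_p E_p) u ∈ U` (N2) and `Σ_p (E_p F_p − F_p E_p) u ∈ U`
  have h1 : (∑ p : α × β, (upqEOp ρ𝔤 (Matrix.single p.1 p.2 1) * upqFOp ρ𝔤 (Matrix.single p.2 p.1 1) +
      upqFOp ρ𝔤 (Matrix.single p.2 p.1 1) * upqEOp ρ𝔤 (Matrix.single p.1 p.2 1))) u ∈ U := by
    have h := upq_sum_pPart_mem_of_kStable_of_casimir ρK ρ𝔤 hV hC hU hu
    have heq := LinearMap.congr_fun (upq_sum_ρ𝔤_upqPBasis_mul_self_eq (ρ𝔤 := ρ𝔤)) u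
    simp only [LinearMap.sum_apply, Module.End.mul_apply] at heq h
    rw [LinearMap.sum_apply]
    simpa only [LinearMap.add_apply, Module.End.mul_apply] using heq ▸ h
  have h2 := upq_sum_upqEOp_upqFOp_sub_apply_mem (ρ𝔤 := ρ𝔤) hU' hu
  have h3 := U.sub_mem h1 h2
  rw [← LinearMap.sub_apply, ← Finset.sum_sub_distrib] at h3
  have h4 : (∑ p : α × β, (upqEOp ρ𝔤 (Matrix.single p.1 p.2 1) * upqFOp ρ𝔤 (Matrix.single p.2 p.1 1) +
      upqFOp ρ𝔤 (Matrix.single p.2 p.1 1) * upqEOp ρ𝔤 (Matrix.single p.1 p.2 1) -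
      (upqEOp ρ𝔤 (Matrix.single p.1 p.2 1) * upqFOp ρ𝔤 (Matrix.single p.2 p.1 1) -
        upqFOp ρ𝔤 (Matrix.single p.2 p.1 1) * upqEOp ρ𝔤 (Matrix.single p.1 p.2 1)))) =
      (2 : ℂ) • ∑ p : α × β, upqFOp ρ𝔤 (Matrix.single p.2 p.1 1) * upqEOp ρ𝔤 (Matrix.single p.1 p.2 1) := by
    rw [Finset.smul_sum]
    refine Finset.sum_congr rfl fun p _ => ?_
    rw [two_smul]; abel
  rw [h4, LinearMap.smul_apply] at h3
  have h5 := U.smul_mem (2⁻¹ : ℂ) h3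
  rw [smul_smul, inv_mul_cancel₀ (two_ne_zero), one_smul, LinearMap.sum_apply] at h5
  simpa only [Module.End.mul_apply] using h5

/-- The same for an IRREDUCIBLE `(𝔤, K)`-module (carrier in `Type`), by N0 ★ `upqCasimirOp_eq_algebraMap_of_isIrreducibleGK`.
[cite: Varadarajan1989, §5.4 (proof of Thm. 22)] [cite: KnappVogan1995, Prop. 4.87] -/
theorem upq_sum_upqFOp_upqEOp_apply_mem_of_isIrreducibleGK {V : Type} [AddCommGroup V] [Module ℂ V]
    {ρK : Representation ℂ (uFormGroup α β).maximalCompact V} {ρ𝔤 : (uFormGroup α β).lie →ₗ⁅ℝ⁆ Module.End ℂ V}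
    (hV : IsGKModule (uFormGroup α β) ρK ρ𝔤) (hirr : IsIrreducibleGK ρK ρ𝔤) {U : Submodule ℂ V}
    (hU : ∀ (k : (uFormGroup α β).maximalCompact), ∀ u ∈ U, ρK k u ∈ U) {u : V} (hu : u ∈ U) :
    (∑ p : α × β, upqFOp ρ𝔤 (Matrix.single p.2 p.1 1) (upqEOp ρ𝔤 (Matrix.single p.1 p.2 1) u)) ∈ U := by
  obtain ⟨c, hc⟩ := upqCasimirOp_eq_algebraMap_of_isIrreducibleGK hV hirr
  exact upq_sum_upqFOp_upqEOp_apply_mem_of_casimir ρK hV hc hU hu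

/-- **THE SYMBOL `q` DROPS TWO LEVELS**: for `K`-stable `W₀` and a scalar Casimir, `Σ_p F_p E_p (E^a W₀) ⊆ E^a W₀ = M_{a,0}`; hence
`F^b (Σ_p F_p E_p) E^a W₀ ⊆ M_{a,b}` — the element `q ⊗ (Sym^{b}(𝔭⁻) ⊗ Sym^{a}(𝔭⁺))` of `Sym^{b+1}(𝔭⁻) ⊗ Sym^{a+1}(𝔭⁺)` acts into the LOWER
level `M_{a,b} ⊆ F_{a+b}`. [cite: Varadarajan1989, §5.4 (proof of Thm. 22)] [cite: BorelWallach2000, II §4.2] -/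
theorem upq_sum_upqFOp_upqEOp_apply_mem_upqLevel_zero (hV : IsGKModule (uFormGroup α β) ρK ρ𝔤) {c : ℂ}
    (hC : upqCasimirOp ρ𝔤 = algebraMap ℂ (Module.End ℂ V) c) {W₀ : Submodule ℂ V}
    (hW₀ : ∀ (k : (uFormGroup α β).maximalCompact), ∀ w ∈ W₀, ρK k w ∈ W₀) (a : ℕ) {u : V} (hu : u ∈ upqLevel ρ𝔤 W₀ a 0) :
    (∑ p : α × β, upqFOp ρ𝔤 (Matrix.single p.2 p.1 1) (upqEOp ρ𝔤 (Matrix.single p.1 p.2 1) u)) ∈ upqLevel ρ𝔤 W₀ a 0 :=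
  upq_sum_upqFOp_upqEOp_apply_mem_of_casimir ρK hV hC (upqLevel_kStable ρK hV hW₀ a 0) hu

end Literature.NumberTheory.Automorphic

end
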